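import Summits.NavierStokesRegularity.NavierStokesRegularity.Theorems.TypeIQuarterGateLorentzUpgradeIffQuarterLaw
import Summits.NavierStokesRegularity.NavierStokesRegularity.Theorems.StretchingWellBindingEnstrophyQuarterLawLambBudgetAssembly
import HarnessLib

/-!
# `TypeIQuarterGate`: per blow-up, the quarter law, the Lorentz bound, the count and ONE-LEVEL volume
# sparseness are the same statement

Crux `QuarterLawTypeI` (stmt-NavierStokesRegularity-23726).  Along ONE maximal smooth Leray–Hopf solution
from a rapidly decaying datum with the sup-norm Type-I rate at `T` (`ν, T > 0`), the following are
EQUIVALENT (`typeI_slice_tfae`):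

1. Leray's quarter rate `∃ K, ∀ t ∈ [0,T), ∫‖curl u(t)‖² ≤ K/√(T−t)` (the conclusion of `QuarterLawTypeI`);
2. the uniform weak-`L³` bound `∃ M', ∀ t ∈ [0,T), sup_λ λ³|{λ<‖u(t)‖}| ≤ M'` (the conclusion of
   `LorentzUpgradeTypeI`);
3. ONE-LEVEL volume sparseness `∃ N, ∀ s ∈ [0,T), |{c₀√(ν/(T−s)) < ‖u(s)‖}| ≤ N (ν(T−s))^{3/2}` at any
   fixed threshold `c₀ ∈ (0,1)` (the crux `VolumeSparsenessLaw` of shelf 1574's LINE 7, per solution);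
4. the scale-uniform `ε`-concentration count (the conclusion of `UniformConcentrationCountTypeI`).

Arrows: 1 ⟹ 4 `CountQuarterLaw.count_of_quarterLaw` (p816056); 4 ⟹ 2 `lorentzBound_of_count` (p818591:
free-scale ε-regularity + packing/covering); 2 ⟹ 3 `LambBudget.volumeSparse_of_weakL3` (Chebyshev at one
level); 3 ⟹ 1 `LambBudget.sliceLaw_iff_typeI_and_volumeSparse` (Lamb slaving).  READING: along a Type-I
blow-up the «intermediate-amplitude clouds» feared in `LorentzUpgradeTypeI`'s docstring at ALL levels are
excluded as soon as the SINGLE near-top level `c₀√(ν/(T−s))` is volume-sparse — one level controls all.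

HONEST FRAMING: an equivalence of four OPEN properties of a HYPOTHETICAL Type-I blow-up; nothing about
Navier–Stokes regularity or blow-up is claimed. [folklore]
-/

-- the problem directory repeats the summit name (`NavierStokesRegularity/NavierStokesRegularity`)
set_option linter.dupNamespace false

noncomputable section

open Set Filter MeasureTheory Topology Metric
open scoped ENNReal NNReal

namespace Summit.NavierStokesRegularity.NavierStokesRegularity.Theorems

namespace LorentzOfEnvelope

open Literature.Analysis.FluidPDE Literature.Analysis.FunctionSpaces

/-- **Per blow-up: quarter law ⟺ Lorentz bound ⟺ one-level volume sparseness ⟺ uniform count.**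
See the module docstring. [folklore] -/
theorem typeI_slice_tfae {c₀ ν T : ℝ} (hc₀ : 0 < c₀) (hc₁ : c₀ < 1) (hν : 0 < ν) (hT : 0 < T)
    {u : ℝ → EuclideanSpace ℝ (Fin 3) → EuclideanSpace ℝ (Fin 3)}
    {p : ℝ → EuclideanSpace ℝ (Fin 3) → ℝ}
    (hmax : IsMaximalSmoothSolution ν 0 u p T) (hLH : IsLerayHopfOn T ν 0 (u 0) u)
    (hdec : HasRapidSpatialDecay (u 0)) (hI : IsTypeIBlowup u T) :
    [∃ K : ℝ, ∀ t ∈ Ico 0 T, ∫⁻ x, ‖curl (u t) x‖ₑ ^ 2 ≤ ENNReal.ofReal (K / Real.sqrt (T - t)),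
      ∃ M' : ℝ, ∀ t ∈ Ico 0 T, eWeakLpPow (u t) 3 volume ≤ ENNReal.ofReal M',
      ∃ N : ℝ, ∀ s ∈ Ico 0 T,
        volume {x : EuclideanSpace ℝ (Fin 3) | c₀ * Real.sqrt (ν / (T - s)) < ‖u s x‖} ≤
          ENNReal.ofReal (N * Real.sqrt (ν * (T - s)) ^ 3),
      ∀ η : ℝ, 0 < η → ∃ N : ℕ, ∃ r₀ : ℝ, 0 < r₀ ∧ ∀ r : ℝ, 0 < r → r ≤ r₀ →
        ∀ σ : Finset (EuclideanSpace ℝ (Fin 3)),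
          (∀ x ∈ σ, ∀ x' ∈ σ, x ≠ x' → 2 * r ≤ ‖x - x'‖) →
          (∀ x ∈ σ, ENNReal.ofReal (η * r) ≤ ∫⁻ s in Ioo (T - r ^ 2) T, ∫⁻ y in ball x r,
            ENNReal.ofReal (frobeniusNormSq (fderiv ℝ (u s) y))) → σ.card ≤ N].TFAE := by
  tfae_have 1 → 4 := by
    rintro ⟨K, hK⟩ η hη
    refine ⟨⌊2 * max K 0 / η⌋₊, Real.sqrt T, Real.sqrt_pos.2 hT, fun r hr hrT σ hsep hconc => ?_⟩
    exact CountQuarterLaw.count_of_quarterLaw hν hT hmax.1 hLH hK hη hr hrT σ hsep hconc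
  tfae_have 4 → 2 := fun hc => lorentzBound_of_count hν hT hmax.1 hLH hdec hI hc
  tfae_have 2 → 3 := by
    rintro ⟨M', hM'⟩
    exact EnstrophyQuarterLaw.LambBudget.volumeSparse_of_weakL3 hc₀ hν hM'
  tfae_have 3 → 1 := fun hV =>
    (EnstrophyQuarterLaw.LambBudget.sliceLaw_iff_typeI_and_volumeSparse hc₀ hc₁ hν hT hmax hLH hdec).2
      ⟨hI, hV⟩
  tfae_finish

/-- **Corollary: one level controls all levels.** Along a Type-I blow-up, volume sparseness of the
single super-level set `{c₀√(ν/(T−s)) < ‖u(s)‖}` (`c₀ ∈ (0,1)`) is equivalent to the uniform weak-`L³`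
bound of all slices. [folklore] -/
theorem volumeSparse_iff_weakL3_of_typeI {c₀ ν T : ℝ} (hc₀ : 0 < c₀) (hc₁ : c₀ < 1) (hν : 0 < ν)
    (hT : 0 < T) {u : ℝ → EuclideanSpace ℝ (Fin 3) → EuclideanSpace ℝ (Fin 3)}
    {p : ℝ → EuclideanSpace ℝ (Fin 3) → ℝ}
    (hmax : IsMaximalSmoothSolution ν 0 u p T) (hLH : IsLerayHopfOn T ν 0 (u 0) u)
    (hdec : HasRapidSpatialDecay (u 0)) (hI : IsTypeIBlowup u T) :
    (∃ N : ℝ, ∀ s ∈ Ico 0 T,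
        volume {x : EuclideanSpace ℝ (Fin 3) | c₀ * Real.sqrt (ν / (T - s)) < ‖u s x‖} ≤
          ENNReal.ofReal (N * Real.sqrt (ν * (T - s)) ^ 3)) ↔
      ∃ M' : ℝ, ∀ t ∈ Ico 0 T, eWeakLpPow (u t) 3 volume ≤ ENNReal.ofReal M' :=
  ((typeI_slice_tfae hc₀ hc₁ hν hT hmax hLH hdec hI).out 2 1 :)

end LorentzOfEnvelope

end Summit.NavierStokesRegularity.NavierStokesRegularity.Theorems
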